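import Literature.AlgebraicTopology.SingularHomology.CohomologyPowerSumsOfField
import Mathlib.LinearAlgebra.Dual.Lemmas
import HarnessLib

/-!
# Over a field, the VARIATION `h^* − 1` of a self-map on cohomology is controlled by `h_* − 1` on homology
# (Kronecker duality: rank and polynomial relations)

Layer `Literature/AlgebraicTopology/SingularHomology`; theorems only (no definition, no named fact). Written by the
prover seat `hodge-nonav-prover-Ax` (g9); sequel of `CohomologyPowerSumsOfField` and companion of
`HomologySelfMapFixingOpenSet` (programme "localisation of the nodal meridian monodromy", route
`Summits/HodgeConjecture/HodgeConjecture/Theses/CyclicUnitaryPowers.lean`, crux K1).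

For a continuous self-map `h : X → X`, a field `F`, `T = h^*` on `Hⁿ(X; F)` and `S = h_*` on `Hₙ(X; F)` (Hatcher
§3.1: the Kronecker map `κ : Hⁿ → Hom(Hₙ, F)` is bijective and `κ ∘ T = Sᵀ ∘ κ`):

* `finrank_range_cohomologyMap_sub_id_eq` — **`rank (T − 1) = rank (S − 1)`** (`κ ∘ (T − 1) = (S − 1)ᵀ ∘ κ` and
  `rank fᵀ = rank f`, Mathlib `LinearMap.finrank_range_dualMap_eq_finrank_range` — no finiteness needed);
* `sum_smul_pow_cohomologyMap_apply_sub_eq_zero` — if `(Σ_i c_i S^i)(S z − z) = 0` for all `z ∈ Hₙ(X; F)` then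
  `(Σ_i c_i T^i)(T a − a) = 0` for all `a ∈ Hⁿ(X; F)`.

With `HomologySelfMapFixingOpenSet` (for `h = id` on an open `B`, `h(A) ⊆ A`, `X = A ∪ B`: `rank (S − 1) ≤ dim Hₙ(A)`
and the local polynomial relations kill `S − 1`) this yields, for `V := range (T − 1)`: `(T − 1)Hⁿ(X) ⊆ V`,
`Σ_i c_i T^i = 0` on `V`, `dim V ≤ dim Hₙ(A; F)` — the shape of the cited fact
`HodgeTheory.carlsonToledo1999_nodalMeridianLocalMonodromyBound`, with NO hypothesis on `A ∩ B`.

## References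

* [HatcherAT2002] A. Hatcher, Algebraic Topology, CUP 2002, §3.1 Thm. 3.2 (p. 195), p. 198, p. 201.
-/

noncomputable section

open CategoryTheory

universe u v

namespace Literature.AlgebraicTopology.SingularHomology

variable (F : Type v) [Field F] {X : Type u} [TopologicalSpace X] (h : C(X, X)) (n : ℕ)

/-- `κ ∘ (h^* − 1) = (h_* − 1)ᵀ ∘ κ` for the Kronecker map `κ` (naturality `⟨h^* a, z⟩ = ⟨a, h_* z⟩`).
[cite: HatcherAT2002, §3.1 p. 201] -/
theorem kroneckerPairing_comp_cohomologyMap_sub_id :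
    (kroneckerPairing F F X n).comp ((singularCohomology.map F F h n).hom - LinearMap.id) =
      ((singularHomology.map F F h n).hom - LinearMap.id).dualMap.comp (kroneckerPairing F F X n) := by
  refine LinearMap.ext fun a => LinearMap.ext fun z => ?_
  have hTS : kroneckerPairing F F X n ((singularCohomology.map F F h n).hom a) z =
      kroneckerPairing F F X n a ((singularHomology.map F F h n).hom z) :=
    kroneckerPairing_map h a z
  simp only [LinearMap.comp_apply, LinearMap.sub_apply, LinearMap.id_apply, map_sub, LinearMap.dualMap_apply, hTS]

/-- **`rank (h^* − 1) = rank (h_* − 1)` over a field** (transpose under the bijective Kronecker map).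
[cite: HatcherAT2002, §3.1 Thm. 3.2 (p. 195), p. 198 and p. 201] -/
theorem finrank_range_cohomologyMap_sub_id_eq :
    Module.finrank F ↥(LinearMap.range ((singularCohomology.map F F h n).hom - LinearMap.id)) =
      Module.finrank F ↥(LinearMap.range ((singularHomology.map F F h n).hom - LinearMap.id)) := by
  have hκ := kroneckerPairing_bijective_of_field F X n
  have h1 : Module.finrank F ↥(LinearMap.range ((singularCohomology.map F F h n).hom - LinearMap.id)) =
      Module.finrank F ↥((LinearMap.range ((singularCohomology.map F F h n).hom - LinearMap.id)).map
        (kroneckerPairing F F X n)) :=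
    (Submodule.equivMapOfInjective (kroneckerPairing F F X n) hκ.1
      (LinearMap.range ((singularCohomology.map F F h n).hom - LinearMap.id))).finrank_eq
  have h2 : (LinearMap.range ((singularCohomology.map F F h n).hom - LinearMap.id)).map (kroneckerPairing F F X n) =
      LinearMap.range ((singularHomology.map F F h n).hom - LinearMap.id).dualMap := by
    rw [← LinearMap.range_comp, kroneckerPairing_comp_cohomologyMap_sub_id,
      LinearMap.range_comp_of_range_eq_top _ (LinearMap.range_eq_top.mpr hκ.2)]
  rw [h1, h2]
  exact LinearMap.finrank_range_dualMap_eq_finrank_range _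

/-- **Polynomial relations killing the homological variation kill the cohomological one**: if
`(Σ_{i<m} c_i h_*^i)(h_* z − z) = 0` for all `z ∈ Hₙ(X; F)`, then `(Σ_{i<m} c_i (h^*)^i)(h^* a − a) = 0` for all
`a ∈ Hⁿ(X; F)` (pair with `z`, move `h` across the Kronecker pairing, commute `h_* − 1` past the polynomial).
[cite: HatcherAT2002, §3.1 Thm. 3.2 (p. 195), p. 198 and p. 201] -/
theorem sum_smul_pow_cohomologyMap_apply_sub_eq_zero (m : ℕ) (c : ℕ → F)
    (hS : ∀ z : singularHomology F F X n, ∑ i ∈ Finset.range m,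
      c i • ((singularHomology.map F F h n).hom ^ i) ((singularHomology.map F F h n).hom z - z) = 0)
    (a : singularCohomology F F X n) :
    ∑ i ∈ Finset.range m, c i • ((singularCohomology.map F F h n).hom ^ i)
      ((singularCohomology.map F F h n).hom a - a) = 0 := by
  have hκ := kroneckerPairing_bijective_of_field F X n
  -- pair with an arbitrary `z`
  apply hκ.1
  rw [map_zero]
  refine LinearMap.ext fun z => ?_
  rw [map_sum, LinearMap.sum_apply, LinearMap.zero_apply]
  have hTS : ∀ (b : singularCohomology F F X n) (w : singularHomology F F X n),
      kroneckerPairing F F X n ((singularCohomology.map F F h n).hom b) w =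
        kroneckerPairing F F X n b ((singularHomology.map F F h n).hom w) := fun b w => kroneckerPairing_map h b w
  -- `S (S^i z) − S^i z = S^i (S z − z)` (the two polynomials in `S = h_*` commute)
  have hcomm : ∀ i : ℕ, (singularHomology.map F F h n).hom (((singularHomology.map F F h n).hom ^ i) z) -
      ((singularHomology.map F F h n).hom ^ i) z =
        ((singularHomology.map F F h n).hom ^ i) ((singularHomology.map F F h n).hom z - z) := fun i => by
    rw [map_sub, ← Module.End.mul_apply, ← Module.End.mul_apply, ← pow_succ', ← pow_succ]
  -- termwise: `⟨c_i T^i (T a − a), z⟩ = ⟨a, c_i S^i (S z − z)⟩`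
  have hterm : ∀ i ∈ Finset.range m,
      kroneckerPairing F F X n (c i • ((singularCohomology.map F F h n).hom ^ i)
        ((singularCohomology.map F F h n).hom a - a)) z =
      kroneckerPairing F F X n a (c i • ((singularHomology.map F F h n).hom ^ i)
        ((singularHomology.map F F h n).hom z - z)) := by
    intro i _
    rw [map_smul, LinearMap.smul_apply, kroneckerPairing_pow_cohomologyMap, map_sub, LinearMap.sub_apply, hTS,
      map_smul, ← hcomm, map_sub]
  rw [Finset.sum_congr rfl hterm, ← map_sum, hS z, map_zero]

end Literature.AlgebraicTopology.SingularHomology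

end
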